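import Summits.ResolutionOfSingularities.ResolutionOfSingularities.Theorems.HilbertSamuelEliminationSigmaMaxModificationsCorridor3WLadderMovingIso
import Summits.ResolutionOfSingularities.ResolutionOfSingularities.Theorems.HilbertSamuelEliminationCampaignW42OracleLocalOpens
import Summits.ResolutionOfSingularities.ResolutionOfSingularities.Theorems.HilbertSamuelEliminationCampaignW42TertiaryGeneralStrata
import HarnessLib

/-!
# [OURS · L1 W4.2] THE CLASS BRIDGE: the `OracleLocal`-class rows close the crux where the all-oracle rows did
# (crux chain w42, W4.2 DEAL D8 «ISO-RESTART AT LOCAL ORACLES» part S4, hand res-D-pv-060)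

OURS (cell `res-hironaka`, slot W4.2, crux `stmt-ResolutionOfSingularities-18506` / conjunct `-19249`; `--supports … --as helper`,
counted 0); NOT statements of the manuscript under review [claim: Hironaka2017, status: under-review] nor of [CossartJannsenSaito2020]
(whose Thm. 1.2 with its Zariski-local functoriality enters BY NAME as the fact `CossartJannsenSaito2020SequenceFunctorial`, F-res2″,
res-type-082 p506669). AI plumbing, weaker than expert review.

## What and why

The registered rows of skeleton `w_ladder` v6 (`Wtop3NonpointedM p`, …, `WB3M`) quantify over ALL functional admissible oracles, and the
moving calibration `Moving.nuMod_threefold_of_noMovingNearChains` / `sigmaMaxModificationsCorridor3_of_noMovingNearChains` instantiates the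
CHOICE oracle (`exists_choiceOracle`). The restart row `IsoOpenRestartM 𝓞 p` of idea-2's card G is meant for the class `𝓞 = OracleLocal`
only (res-type-082's `…CampaignW42OracleLocal`), so cover B with the restart yields the core row FOR LOCAL ORACLES
(`rowO_of_coverB`, not the all-oracle `Wtop3NonpointedM p`). This file shows that nothing is lost:

* `wtopRecIsoMO_of_wtopRecIsoM`, `wtopEvNonIsoMO_of_wtopEvNonIsoM` — all-oracle rows restrict to any class (cf. `atQO_of_atQ`);
* **`rowO_local_of_coverB_restart`** — `WtopRecIsoM p QPointed → WtopEvNonIsoM p QNonpointed → IsoOpenRestartM OracleLocal p →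
  MaxOriginNoMovingNearChainAtQO OracleLocal p 3 QNonpointed (3 ≤ ē)`: THE CORE in `OracleLocal`-class form (the shape of the DEAL's
  «class bridge», with the honest conclusion: a restart valid for local oracles gives the local-class row);
* `answers_of_dim_le_three_general_of_scope` — (H2) in dimension three for oracles answering on `CJSScope` only, ARBITRARY maximal
  stratum (082's `answers_of_dim_le_three_of_scope` without the isolated-origin hypothesis; proof = `answers_of_dim_le_three_general`
  verbatim with the CJS call replaced by the scope answer);
* **`nuMod_threefold_of_noMovingNearChains_local`**, **`sigmaMaxModificationsCorridor3_of_noMovingNearChains_local`** — the moving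
  calibration RE-RUN WITH THE LOCAL ORACLE of CJS Thm. 1.2 (`exists_localOracle_abs`, F-res2″ BY NAME): the hypothesis «no moving near
  chain» is now asked ONLY of functional admissible oracles which are `OracleLocal` and answer on `CJSScope` — so every `OracleLocal`-class
  row of the W-ladder closes the crux exactly where its all-oracle original did.

[cite: CossartJannsenSaito2020, Thm. 1.2 (p. 5), Rem. 6.29 (1), Def. 6.14, Def. 6.15]
-/

set_option linter.dupNamespace false

open CategoryTheory AlgebraicGeometry TopologicalSpace
open Summit.ResolutionOfSingularities.ResolutionOfSingularities.Theorems.CampaignW42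
open Literature.AlgebraicGeometry.Resolution Literature.RingTheory.HilbertSamuel
open Literature.AlgebraicGeometry.CossartJannsenSaito2020
open Summit.ResolutionOfSingularities.ResolutionOfSingularities.Theses.HilbertSamuelElimination
open Summit.ResolutionOfSingularities.ResolutionOfSingularities.Theorems.SigmaMaxModificationsCorridor3
open Summit.ResolutionOfSingularities.ResolutionOfSingularities.Theorems.SigmaMaxModificationsCorridor3.Moving
open Summit.ResolutionOfSingularities.ResolutionOfSingularities.Theorems.SigmaMaxModificationsCorridor3.Helpers (QPointed)

universe u

/-! ## §1. All-oracle rows restrict to the local class; cover B with the restart, local class -/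

namespace Summit.ResolutionOfSingularities.ResolutionOfSingularities.Cruxes.SigmaMaxModifications.IdeasL1Idea2R4

/-- Recurrent class rows are WEAKER than the registered (all-oracle) recurrent rows. [folklore] -/
theorem recAtQO_of_recAtQ {𝓞 : (∀ S : Scheme.{u}, CentreSeq S → Prop) → Prop} {p N : ℕ}
    {Q : ℕ → (ℕ → ℕ) → ∀ X : Scheme.{u}, X → Prop} {G B : MarkedStage.{u} → Prop}
    (h : MaxOriginNoMovingRecurrentNearChainAtQ.{u} p N Q G B) : MaxOriginNoMovingRecurrentNearChainAtQO 𝓞 p N Q G B :=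
  fun R hRf hRa _ ν X _ x hX hQ => h R hRf hRa ν X x hX hQ

/-- Rec-Iso for all oracles gives Rec-Iso for any oracle class. [folklore] -/
theorem wtopRecIsoMO_of_wtopRecIsoM {𝓞 : (∀ S : Scheme.{u}, CentreSeq S → Prop) → Prop} {p : ℕ}
    {Q : ℕ → (ℕ → ℕ) → ∀ X : Scheme.{u}, X → Prop} (h : WtopRecIsoM.{u} p Q) : WtopRecIsoMO.{u} 𝓞 p Q :=
  recAtQO_of_recAtQ h

/-- Ev-NonIso for all oracles gives Ev-NonIso for any oracle class. [folklore] -/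
theorem wtopEvNonIsoMO_of_wtopEvNonIsoM {𝓞 : (∀ S : Scheme.{u}, CentreSeq S → Prop) → Prop} {p : ℕ}
    {Q : ℕ → (ℕ → ℕ) → ∀ X : Scheme.{u}, X → Prop} (h : WtopEvNonIsoM.{u} p Q) : WtopEvNonIsoMO.{u} 𝓞 p Q :=
  atQO_of_atQ h

/-- [OURS · L1 W4.2] **THE CORE IN `OracleLocal`-CLASS FORM, from the pointed units-half, the companion half and the restart at local
oracles** (cover B: `rowO_of_coverB` at `𝓞 = OracleLocal`, fed the all-oracle rows through the two restrictions above). This is the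
honest reading of the DEAL's «class bridge» shape `WtopRecIsoM p QPointed → WtopEvNonIsoM p QNonpointed → IsoOpenRestartM OracleLocal p → …`:
a restart valid for LOCAL oracles yields the row for LOCAL oracles; §2 shows that this class row closes the crux where the all-oracle row
`Wtop3NonpointedM p` did. [cite: CossartJannsenSaito2020, Thm. 1.2 (p. 5), §1.3, p. 107] -/
theorem rowO_local_of_coverB_restart {p : ℕ} (hrec : WtopRecIsoM.{u} p QPointed) (hev : WtopEvNonIsoM.{u} p QNonpointed)
    (hR : IsoOpenRestartM.{u} OracleLocal.{u} p) :
    MaxOriginNoMovingNearChainAtQO.{u} OracleLocal.{u} p 3 QNonpointed fun s => 3 ≤ s.geomDirDim :=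
  rowO_of_coverB hR (wtopRecIsoMO_of_wtopRecIsoM hrec) (wtopEvNonIsoMO_of_wtopEvNonIsoM hev)

/-- The same at POINTED origins (so both registered W-top stubs have their `OracleLocal`-class forms from the three pieces).
[cite: CossartJannsenSaito2020, Thm. 1.2 (p. 5), p. 107] -/
theorem rowO_local_pointed_of_coverB_restart {p : ℕ} (hrec : WtopRecIsoM.{u} p QPointed) (hev : WtopEvNonIsoM.{u} p QPointed)
    (hR : IsoOpenRestartM.{u} OracleLocal.{u} p) :
    MaxOriginNoMovingNearChainAtQO.{u} OracleLocal.{u} p 3 QPointed fun s => 3 ≤ s.geomDirDim :=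
  rowO_of_coverB hR (wtopRecIsoMO_of_wtopRecIsoM hrec) (wtopEvNonIsoMO_of_wtopEvNonIsoM hev)

/-- **Class rows at all origins from class rows at pointed and at non-pointed origins** (the origin is pointed or not). [folklore] -/
theorem atQO_all_of_pointed_nonpointed {𝓞 : (∀ S : Scheme.{u}, CentreSeq S → Prop) → Prop} {p N : ℕ}
    {G : MarkedStage.{u} → Prop} (hP : MaxOriginNoMovingNearChainAtQO 𝓞 p N QPointed G)
    (hN : MaxOriginNoMovingNearChainAtQO 𝓞 p N QNonpointed G) : MaxOriginNoMovingNearChainAtQO 𝓞 p N QAll G := by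
  intro R hRf hRa hO ν X _ x hX _
  by_cases hQ : QPointed N ν X x
  · exact hP R hRf hRa hO ν X x hX hQ
  · exact hN R hRf hRa hO ν X x hX hQ

end Summit.ResolutionOfSingularities.ResolutionOfSingularities.Cruxes.SigmaMaxModifications.IdeasL1Idea2R4

/-! ## §2. The moving calibration re-run with the LOCAL oracle of CJS Thm. 1.2 -/

namespace Summit.ResolutionOfSingularities.ResolutionOfSingularities.Theorems

namespace CampaignW42

variable {R : ∀ S : Scheme.{u}, CentreSeq S → Prop} {N : ℕ} {ν : ℕ → ℕ} {k : Type u} [Field k]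

/-- [OURS · L1 W4.2] **(H2) IN DIMENSION THREE FOR SCOPE-ANSWERING ORACLES, ARBITRARY MAXIMAL STRATUM** (`answers_of_dim_le_three_general`
for oracles answering on `CJSScope` only, e.g. the local oracle of CJS Thm. 1.2; = res-type-082's `answers_of_dim_le_three_of_scope`
without the isolated-origin hypothesis). `X` reduced of finite type over `k`, `dim X ≤ 3`, `dim X ≤ N`, `ν ≠ Φ^{(N)}` maximal: along every
canonical run `s` of `S(X, ν)` the reduced closed subscheme on a closed non-empty `Z ⊆ X_s(ν)` is reduced, excellent, Noetherian of
dimension `≤ 2` (stages stay of finite type over `k`, reduced, of dimension `≤ 3`, `ν` never exceeded — `stateGood_init_general` and its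
propagation), so the oracle answers there. Proof = `answers_of_dim_le_three_general` verbatim up to its last line.
[cite: CossartJannsenSaito2020, Thm. 1.2 (p. 5), Rem. 6.29 (1)] -/
theorem answers_of_dim_le_three_general_of_scope (hRa : OracleAdmissible R)
    (hRtot : ∀ S : Scheme.{u}, CJSScope S → ∃ t, R S t)
    {X : Scheme.{u}} [IsLocallyNoetherian X] (f : X ⟶ Spec (.of k)) [LocallyOfFiniteType f] [QuasiCompact f]
    [IsReduced X] (hdimN : topologicalKrullDim X ≤ (N : WithBot ℕ∞)) (hmax : Maximal (· ∈ Scheme.hsValues X N) ν)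
    (hν : ν ≠ iterPSum N Phi) (hdim3 : topologicalKrullDim X ≤ ((3 : ℕ) : WithBot ℕ∞)) (s : CentreSeq X)
    (hs : s.IsCanonicalRun R N ν) (Z : Set s.top) (hZ : IsClosed Z) (hZν : Z ⊆ Scheme.hsStratum s.top N ν)
    (_hne : Z.Nonempty) : ∃ t, R (Scheme.IdealSheafData.vanishingIdeal ⟨Z, hZ⟩).subscheme t := by
  have hgood : StateGood k R N ν X (Labelling.init X) none := stateGood_init_general hRa f hdimN hmax hν
  obtain ⟨L', P', hg'⟩ := exists_stateGood_top_of_run s.length hgood s hs rfl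
  obtain ⟨g, hgft, hgqc⟩ := hg'.overField
  haveI := hgft
  haveI := hgqc
  haveI : IsLocallyNoetherian s.top := hg'.isLocallyNoetherian
  haveI : IsNoetherian s.top := hg'.isNoetherian
  haveI : IsReduced s.top := SigmaMaxModifications.Sketch.isReduced_top s
  have hdim3' : topologicalKrullDim s.top ≤ ((3 : ℕ) : WithBot ℕ∞) := CentreSeq.topologicalKrullDim_top_le s hdim3
  set T := (Scheme.IdealSheafData.vanishingIdeal ⟨Z, hZ⟩ : s.top.IdealSheafData) with hT
  haveI : IsReduced T.subscheme := ComponentGluing.isReduced_subscheme_vanishingIdeal ⟨Z, hZ⟩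
  haveI : IsNoetherian T.subscheme := Scheme.isNoetherian_of_finiteType_over_field (T.subschemeι ≫ g)
  have hexcT : Scheme.IsExcellent T.subscheme :=
    Scheme.isExcellent_of_locallyOfFiniteType Stacks07QW_field_holds (T.subschemeι ≫ g)
  have hdimT : topologicalKrullDim T.subscheme ≤ 2 := by
    rw [hT, topologicalKrullDim_subscheme_vanishingIdeal]
    exact_mod_cast topologicalKrullDim_le_two_of_subset_hsStratum hν hg'.dim_le hdim3' hZ hZν
  exact hRtot _ ⟨inferInstance, inferInstance, hexcT, hdimT⟩

end CampaignW42

end Summit.ResolutionOfSingularities.ResolutionOfSingularities.Theorems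

namespace Summit.ResolutionOfSingularities.ResolutionOfSingularities.Theorems.SigmaMaxModificationsCorridor3.Moving

/-- [OURS · L1 W4.2] **THREEFOLDS, arbitrary maximal stratum, WITH THE LOCAL ORACLE: pointwise «no moving near chain» asked of
LOCAL scope-answering oracles only + CJS Thm. 1.2 (functorial form, F-res2″) + L∞ ⇒ `ν`-modification.** `Y` reduced of finite type
over a field `k`, `dim Y ≤ 3`, `dim Y ≤ N`, `dim Y ≤ d`, `ν ≠ Φ^{(N)}` maximal. The oracle instantiated is res-type-082's absolutely local
oracle of CJS Thm. 1.2 (`exists_localOracle_abs`), in place of the choice oracle of `nuMod_threefold_of_noMovingNearChains`.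
[cite: CossartJannsenSaito2020, Thm. 1.2 (p. 5), Def. 6.14, Rem. 6.29 (1), p. 107] -/
theorem nuMod_threefold_of_noMovingNearChains_local (hL : MovingCompactness.{0})
    (hF : CossartJannsenSaito2020SequenceFunctorial.{0}) {N : ℕ} {ν : ℕ → ℕ} {k : Type} [Field k] {Y : Scheme.{0}}
    [IsLocallyNoetherian Y] (g : Y ⟶ Spec (.of k)) [LocallyOfFiniteType g] [QuasiCompact g] [IsReduced Y]
    (hdim3 : topologicalKrullDim Y ≤ ((3 : ℕ) : WithBot ℕ∞)) (hdimN : topologicalKrullDim Y ≤ (N : WithBot ℕ∞)) {d : ℕ}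
    (hdimd : topologicalKrullDim Y ≤ (d : WithBot ℕ∞)) (hmax : Maximal (· ∈ Scheme.hsValues Y N) ν) (hν : ν ≠ iterPSum N Phi)
    (hO2 : ∀ R : ∀ S : Scheme.{0}, CentreSeq S → Prop, OracleFunctional R → OracleAdmissible R → OracleLocal R →
      (∀ S : Scheme.{0}, CJSScope S → ∃ t, R S t) →
      ∀ y ∈ Scheme.hsStratum Y N ν, IsClosed ({y} : Set Y) →
        NoMovingNearChainFrom R N ν (MarkedStage.init Y y) fun _ => True) :
    TameWild.NuMod Y N d ν := by
  obtain ⟨R, hRf, hRa, hRl, -, hRt⟩ := exists_localOracle_abs hF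
  exact nuMod_of_forall_noMovingNearChain hL hRf hRa g hdimN hdimd hmax hν
    (fun s hs Z hZ hZν hne => answers_of_dim_le_three_general_of_scope hRa hRt g hdimN hmax hν hdim3 s hs Z hZ hZν hne)
    (hO2 R hRf hRa hRl hRt)

/-- [OURS · L1 W4.2] **THE MOVING CALIBRATION WITH THE LOCAL ORACLE: `SigmaMaxModificationsCorridor3` FROM (F-res2″) CJS Thm. 1.2 in
functorial form, (L∞) moving compactness, AND (B-local) «no MOVING near chain from any closed point of a maximal stratum of a threefold,
for every functional admissible LOCAL oracle answering on `CJSScope`».** Drop-in companion of `sigmaMaxModificationsCorridor3_of_noMovingNearChains`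
with the choice oracle replaced by the local one — so the `OracleLocal`-class rows of the W-ladder (e.g. `rowO_local_of_coverB_restart`)
suffice for the crux. Conditional (does not close the item): (F-res2″) named fact, (L∞) typed row (landed as a theorem, p500208),
(B-local) open. [cite: CossartJannsenSaito2020, Thm. 1.2 (p. 5), Def. 6.15, Rem. 6.29 (1), p. 107] -/
theorem sigmaMaxModificationsCorridor3_of_noMovingNearChains_local (hL : MovingCompactness.{0})
    (hF : CossartJannsenSaito2020SequenceFunctorial.{0})
    (hO2 : ∀ (k : Type) [Field k] (Y : Scheme.{0}) [IsLocallyNoetherian Y] (g : Y ⟶ Spec (.of k))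
      [LocallyOfFiniteType g] [QuasiCompact g] [IsReduced Y] (N : ℕ) (ν : ℕ → ℕ),
      topologicalKrullDim Y ≤ ((3 : ℕ) : WithBot ℕ∞) → topologicalKrullDim Y ≤ (N : WithBot ℕ∞) →
      Maximal (· ∈ Scheme.hsValues Y N) ν → ν ≠ iterPSum N Phi →
      ∀ R : ∀ S : Scheme.{0}, CentreSeq S → Prop, OracleFunctional R → OracleAdmissible R → OracleLocal R →
        (∀ S : Scheme.{0}, CJSScope S → ∃ t, R S t) →
        ∀ y ∈ Scheme.hsStratum Y N ν, IsClosed ({y} : Set Y) →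
          NoMovingNearChainFrom R N ν (MarkedStage.init Y y) fun _ => True) :
    SigmaMaxModificationsCorridor3 := by
  rw [TameWild.sigmaMaxModificationsCorridor3_iff]
  intro p _ k _ _ X f hsep hft hqc hred hreg _ hd3 N hdN _
  refine TameWild.hsBody_of_nuMods' k N 3 ?_ X f hsep hft hqc hred hreg hd3 hdN
  intro Y g _ hft' hqc' hred' hd3' hdN' ν hν hνΦ
  haveI := hft'
  haveI := hqc'
  haveI := hred'
  haveI : IsLocallyNoetherian Y := LocallyOfFiniteType.isLocallyNoetherian g
  exact nuMod_threefold_of_noMovingNearChains_local hL hF g hd3' hdN' hd3' hν hνΦ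
    fun R hRf hRa hRl hRt => hO2 k Y g N ν hd3' hdN' hν hνΦ R hRf hRa hRl hRt

/-- [OURS · L1 W4.2] **`nuMod_three` FROM THE `OracleLocal`-CLASS ROW** — the statement the skeleton's `nuMod_three` consumes
(`nuMod_three_of_WAM_WBM`'s conclusion, threefolds at level `3`), obtained from L∞, F-res2″ and «no moving near chain from any maximal
origin at level 3, for every functional admissible LOCAL oracle» (`MaxOriginNoMovingNearChainAtQO OracleLocal p 3 QAll ⊤`, the local-class
`WB3M`). So a skeleton built on `OracleLocal`-class rows composes to the crux exactly as `w_ladder` v6 does.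
[cite: CossartJannsenSaito2020, Thm. 1.2 (p. 5), Rem. 6.29 (1), Def. 6.14] -/
theorem nuMod_three_of_rowO_local (hL : MovingCompactness.{0}) (hF : CossartJannsenSaito2020SequenceFunctorial.{0})
    (p : ℕ) (_hp : p.Prime)
    (hrow : Cruxes.SigmaMaxModifications.IdeasL1Idea2R4.MaxOriginNoMovingNearChainAtQO.{0} OracleLocal p 3
      Cruxes.SigmaMaxModifications.IdeasL1Idea2R4.QAll fun _ => True)
    (k : Type) [Field k] [CharP k p] :
    ∀ (Y : Scheme.{0}) (g : Y ⟶ Spec (.of k)), IsSeparated g → LocallyOfFiniteType g →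
      QuasiCompact g → IsReduced Y → topologicalKrullDim Y ≤ ((3 : ℕ) : WithBot ℕ∞) →
      topologicalKrullDim Y ≤ ((3 : ℕ) : WithBot ℕ∞) →
      ∀ ν : ℕ → ℕ, Maximal (· ∈ Scheme.hsValues Y 3) ν → ν ≠ iterPSum 3 Phi → TameWild.NuMod Y 3 3 ν := by
  intro Y g hsep hft hqc hred hdim _ ν hmax hne
  haveI := hft
  haveI := hqc
  haveI := hred
  haveI : IsLocallyNoetherian Y := LocallyOfFiniteType.isLocallyNoetherian g
  exact nuMod_threefold_of_noMovingNearChains_local hL hF g hdim hdim hdim hmax hne fun R hRf hRa hRl _ y hy hyc =>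
    hrow R hRf hRa hRl ν Y y ⟨⟨k, inferInstance, inferInstance, g, hsep, hft, hqc⟩, hred, hdim, hmax, hyc, hy⟩ trivial

end Summit.ResolutionOfSingularities.ResolutionOfSingularities.Theorems.SigmaMaxModificationsCorridor3.Moving
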